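import Literature.Probability.Percolation.LonelyClusterExchange
import Literature.Probability.Percolation.KozmaNitzanPreFKG
import HarnessLib

/-!
# `NoHeavyLowerTail` (stmt-CriticalPhenomena-4575) — ANCHORED lonelier-member inequalities
# ("gluing a relay set damages no outsider more than the lightest member": the pair case and the easy regime)

Prover `prim-gen-induct` (gen 6), `--supports stmt-CriticalPhenomena-4575`.  No definitions, no named facts,
no sorries; standard axioms.

Setting: bond percolation `μ = prodBernoulli w` on a finite vertex type, relays `A`, level `j`,
`R_y = {|π(y)| ≤ j}` (`π(y) = A.filter (y ↔ ·)`), `I(y) = μ(R_y)`.  For a finite relay set `B` and a vertex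
`x ∉ B` put (BLOBQUOTIENT.md §25 of the crux notes)

  `T_B(x) := μ(x ↔ B, R_x) + μ(x ↮ B, 1 ≤ |π(B)| ≤ j)`,   `π(B) = A.filter (∃ b ∈ B, b ↔ ·)`,

so that the set-CS difference is `Δ(B; x) = I(x) − T_B(x)` and, in gluing form, `T_B(x) = I(x) − I_{G^B}(x) + I_{G^B}(B)`.
The ANCHORED lonelier-member inequality (conjecture RHLA, 0 violations in the census of §25) says
`T_B(x) ≤ max_{g ∈ B} I(g)`, i.e. gluing `B` damages the outsider `x` at most as much as it damages the lightest
member of `B`.  This file proves the two halves that follow from ONE two-cluster exchange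
(van den Berg–Häggström–Kahn 2006, Thm. 1.5, tree `lonelyClusterExchange` / `twoClusterExchange`):

* `AnchoredLonelier.attached_transfer`: `I(g) ≤ I(a)` ⇒ `μ(g ↮ a, g ↔ x, R_g) ≤ μ(g ↮ a, g ↔ x, R_a)`
  (loneliness transfer along an attached marker `x`; the linearised `lonelyClusterExchange`).
* `AnchoredLonelier.union_transfer`: `I(x) ≤ I(q)` ⇒ `μ(x ↮ q, x ↔ W, R_x) ≤ μ(x ↮ q, x ↔ W, R_q)` for every finite
  vertex set `W` (`{x ↔ W} = ⋃_{w ∈ W} {x ↔ w}` is of type `(+)` for the pair `(x, q)`).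
* `AnchoredLonelier.pair_anchored` (**RHLA for |B| = 2, both regimes**): for `B = {a, g}` with `I(g) ≤ I(a)` and any
  vertex `x ∉ B`:  `T_B(x) ≤ I(a)`.
* `AnchoredLonelier.set_anchored_of_le` (**RHLA, easy regime, any |B|**): if `q ∈ B` and `I(x) ≤ I(q)` then
  `T_B(x) ≤ I(q)` — for `|B| = 2` this is `ExchangeTools.glueCost_le`, for general `B` it is the additive form
  `Δ(B; x) ≥ min(0, I(x) − I(q))` of `observerSet_le_of_lonelier`.

What is NOT here (open, §25): `|B| ≥ 3` with `x` lighter than every member of `B`.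
-/

noncomputable section

open MeasureTheory Set
open Literature.Probability.LatticeModels (prodBernoulli)
open Literature.Probability.Percolation
open scoped Classical

namespace Summit.CriticalPhenomena.PercolationContinuityZ3.Theorems

namespace AnchoredLonelier

variable {V : Type*} [Fintype V]

omit [Fintype V] in
/-- On `{s ↔ t}` the loneliness events of `s` and `t` coincide: `R_t ∖ {s ↮ t} = R_s ∖ {s ↮ t}`. [folklore] -/
theorem lonely_sdiff_eq (A : Finset V) (j : ℕ) (s t : V) :
    ({ω : BondConfig V | (A.filter fun z => ω ∈ openConn t z).card ≤ j} \ (openConn s t)ᶜ) =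
      ({ω : BondConfig V | (A.filter fun z => ω ∈ openConn s z).card ≤ j} \ (openConn s t)ᶜ) := by
  ext ω
  simp only [mem_sdiff, mem_compl_iff, not_not, mem_setOf_eq]
  constructor
  · rintro ⟨h, hst⟩
    have hst' : (openGraph ω).Reachable s t := hst
    have heq : (A.filter fun z => ω ∈ openConn s z) = (A.filter fun z => ω ∈ openConn t z) :=
      Finset.filter_congr fun z _ =>
        ⟨fun hz => (hst'.symm.trans hz : (openGraph ω).Reachable t z),
          fun hz => (hst'.trans hz : (openGraph ω).Reachable s z)⟩
    rw [heq]; exact ⟨h, hst⟩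
  · rintro ⟨h, hst⟩
    have hst' : (openGraph ω).Reachable s t := hst
    have heq : (A.filter fun z => ω ∈ openConn t z) = (A.filter fun z => ω ∈ openConn s z) :=
      Finset.filter_congr fun z _ =>
        ⟨fun hz => (hst'.trans hz : (openGraph ω).Reachable s z),
          fun hz => (hst'.symm.trans hz : (openGraph ω).Reachable t z)⟩
    rw [heq]; exact ⟨h, hst⟩

/-- Restricted comparison: if `μ(R_s) ≤ μ(R_t)` then `μ({s ↮ t} ∩ R_s) ≤ μ({s ↮ t} ∩ R_t)`
(the two events agree off `{s ↮ t}`). [folklore] -/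
theorem lonely_inter_le (w : Sym2 V → unitInterval) (A : Finset V) (j : ℕ) (s t : V)
    (hle : (prodBernoulli w).real {ω : BondConfig V | (A.filter fun z => ω ∈ openConn s z).card ≤ j} ≤
      (prodBernoulli w).real {ω : BondConfig V | (A.filter fun z => ω ∈ openConn t z).card ≤ j}) :
    (prodBernoulli w).real ((openConn s t)ᶜ ∩ {ω : BondConfig V | (A.filter fun z => ω ∈ openConn s z).card ≤ j}) ≤
      (prodBernoulli w).real ((openConn s t)ᶜ ∩ {ω : BondConfig V | (A.filter fun z => ω ∈ openConn t z).card ≤ j}) := by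
  set μ := prodBernoulli w with hμ
  set Rs : Set (BondConfig V) := {ω | (A.filter fun z => ω ∈ openConn s z).card ≤ j} with hRs
  set Rt : Set (BondConfig V) := {ω | (A.filter fun z => ω ∈ openConn t z).card ≤ j} with hRt
  set D : Set (BondConfig V) := (openConn s t)ᶜ with hD
  have hmeas : ∀ S : Set (BondConfig V), MeasurableSet S := fun S => (Set.toFinite S).measurableSet
  have hF : Rt \ D = Rs \ D := lonely_sdiff_eq A j s t
  have hsplit_t : μ.real (Rt ∩ D) + μ.real (Rt \ D) = μ.real Rt := measureReal_inter_add_sdiff (hmeas D)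
  have hsplit_s : μ.real (Rs ∩ D) + μ.real (Rs \ D) = μ.real Rs := measureReal_inter_add_sdiff (hmeas D)
  rw [inter_comm D Rs, inter_comm D Rt]
  rw [hF] at hsplit_t
  linarith

/-- **Attached transfer.**  If `g ≠ a` and `μ(R_g) ≤ μ(R_a)`, then for every vertex `x`:
`μ(g ↮ a, g ↔ x, R_g) ≤ μ(g ↮ a, g ↔ x, R_a)` — the loneliness of `g` transfers to the lonelier `a`
along the increasing marker event `{g ↔ x}` (linearised `lonelyClusterExchange` with `(s,t) := (a,g)`). -/
theorem attached_transfer (w : Sym2 V → unitInterval) (A : Finset V) (j : ℕ) {g a : V} (hga : g ≠ a) (x : V)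
    (hle : (prodBernoulli w).real {ω : BondConfig V | (A.filter fun z => ω ∈ openConn g z).card ≤ j} ≤
      (prodBernoulli w).real {ω : BondConfig V | (A.filter fun z => ω ∈ openConn a z).card ≤ j}) :
    (prodBernoulli w).real ((openConn a g)ᶜ ∩
        ({ω : BondConfig V | (A.filter fun z => ω ∈ openConn g z).card ≤ j} ∩ openConn g x)) ≤
      (prodBernoulli w).real ((openConn a g)ᶜ ∩
        (openConn g x ∩ {ω : BondConfig V | (A.filter fun z => ω ∈ openConn a z).card ≤ j})) := by
  set μ := prodBernoulli w with hμ
  set Rg : Set (BondConfig V) := {ω | (A.filter fun z => ω ∈ openConn g z).card ≤ j} with hRg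
  set Ra : Set (BondConfig V) := {ω | (A.filter fun z => ω ∈ openConn a z).card ≤ j} with hRa
  set D : Set (BondConfig V) := (openConn a g)ᶜ with hD
  set X : Set (BondConfig V) := openConn g x with hX
  -- exchange with `s := a`, `t := g`
  have key : μ.real (D ∩ (Rg ∩ X)) * μ.real (D ∩ Ra) ≤ μ.real (D ∩ Rg) * μ.real (D ∩ (X ∩ Ra)) :=
    lonelyClusterExchange w hga.symm x A j
  -- restricted comparison `μ(D ∩ R_g) ≤ μ(D ∩ R_a)`
  have hcmp : μ.real (D ∩ Rg) ≤ μ.real (D ∩ Ra) := by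
    have h := lonely_inter_le w A j g a hle
    rw [KNPreFKG.openConn_symm g a] at h
    exact h
  have hm1 : μ.real (D ∩ (Rg ∩ X)) ≤ μ.real (D ∩ Rg) :=
    measureReal_mono (inter_subset_inter_right _ inter_subset_left)
  by_cases h0 : μ.real (D ∩ Ra) = 0
  · have h1 : μ.real (D ∩ Rg) = 0 := le_antisymm (h0 ▸ hcmp) measureReal_nonneg
    have h2 : μ.real (D ∩ (Rg ∩ X)) = 0 := le_antisymm (h1 ▸ hm1) measureReal_nonneg
    rw [h2]; exact measureReal_nonneg
  · have hpos : 0 < μ.real (D ∩ Ra) := lt_of_le_of_ne measureReal_nonneg (Ne.symm h0)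
    have key' : μ.real (D ∩ (Rg ∩ X)) * μ.real (D ∩ Ra) ≤ μ.real (D ∩ Ra) * μ.real (D ∩ (X ∩ Ra)) :=
      key.trans (mul_le_mul_of_nonneg_right hcmp measureReal_nonneg)
    rw [mul_comm] at key'
    exact le_of_mul_le_mul_left key' hpos

/-- **Union transfer.**  If `x ≠ q` and `μ(R_x) ≤ μ(R_q)`, then for every finite vertex set `W`:
`μ(x ↮ q, x ↔ W, R_x) ≤ μ(x ↮ q, x ↔ W, R_q)`, where `{x ↔ W} = ⋃_{b ∈ W} {x ↔ b}` is closed under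
enlarging `C_x` (type `(+)` for the pair `(x,q)`).  (`twoClusterExchange` with `A₁ = {x ↔ W}`, `B₁ = R_x`,
`A₂ = R_q`, `B₂ = Ω`, then the restricted comparison.) -/
theorem union_transfer (w : Sym2 V → unitInterval) (A : Finset V) (j : ℕ) {x q : V} (hxq : x ≠ q)
    (W : Finset V)
    (hle : (prodBernoulli w).real {ω : BondConfig V | (A.filter fun z => ω ∈ openConn x z).card ≤ j} ≤
      (prodBernoulli w).real {ω : BondConfig V | (A.filter fun z => ω ∈ openConn q z).card ≤ j}) :
    (prodBernoulli w).real ((openConn x q)ᶜ ∩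
        ((⋃ b ∈ W, (openConn x b : Set (BondConfig V))) ∩
          {ω : BondConfig V | (A.filter fun z => ω ∈ openConn x z).card ≤ j})) ≤
      (prodBernoulli w).real ((openConn x q)ᶜ ∩
        ((⋃ b ∈ W, (openConn x b : Set (BondConfig V))) ∩
          {ω : BondConfig V | (A.filter fun z => ω ∈ openConn q z).card ≤ j})) := by
  set μ := prodBernoulli w with hμ
  set Rx : Set (BondConfig V) := {ω | (A.filter fun z => ω ∈ openConn x z).card ≤ j} with hRx
  set Rq : Set (BondConfig V) := {ω | (A.filter fun z => ω ∈ openConn q z).card ≤ j} with hRq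
  set D : Set (BondConfig V) := (openConn x q)ᶜ with hD
  set U : Set (BondConfig V) := ⋃ b ∈ W, (openConn x b : Set (BondConfig V)) with hU
  have hUtype : ∀ ⦃ω ω' : BondConfig V⦄, openEdgeCluster ω x ⊆ openEdgeCluster ω' x →
      openEdgeCluster ω' q ⊆ openEdgeCluster ω q → ω ∈ U → ω' ∈ U := by
    intro ω ω' h1 h2 hω
    rw [hU, mem_iUnion₂] at hω ⊢
    obtain ⟨b, hb, hωb⟩ := hω
    exact ⟨b, hb, typePlus_openConn x q b h1 h2 hωb⟩
  have key := twoClusterExchange w hxq (A₁ := U) (A₂ := Rq) (B₁ := Rx) (B₂ := (univ : Set (BondConfig V)))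
    hUtype (LonelyClusterExchange.typePlus_card_le A j x q) (LonelyClusterExchange.typeMinus_card_le A j x q)
    (fun _ _ _ _ _ => mem_univ _)
  simp only [inter_univ] at key
  -- key : μ(D ∩ (U ∩ Rx)) * μ(D ∩ Rq) ≤ μ(D ∩ (U ∩ Rq)) * μ(D ∩ Rx)
  have hcmp : μ.real (D ∩ Rx) ≤ μ.real (D ∩ Rq) := lonely_inter_le w A j x q hle
  have hm1 : μ.real (D ∩ (U ∩ Rx)) ≤ μ.real (D ∩ Rx) :=
    measureReal_mono (inter_subset_inter_right _ inter_subset_right)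
  by_cases h0 : μ.real (D ∩ Rq) = 0
  · have h1 : μ.real (D ∩ Rx) = 0 := le_antisymm (h0 ▸ hcmp) measureReal_nonneg
    have h2 : μ.real (D ∩ (U ∩ Rx)) = 0 := le_antisymm (h1 ▸ hm1) measureReal_nonneg
    rw [h2]; exact measureReal_nonneg
  · have hpos : 0 < μ.real (D ∩ Rq) := lt_of_le_of_ne measureReal_nonneg (Ne.symm h0)
    have key' : μ.real (D ∩ (U ∩ Rx)) * μ.real (D ∩ Rq) ≤ μ.real (D ∩ Rq) * μ.real (D ∩ (U ∩ Rq)) := by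
      calc μ.real (D ∩ (U ∩ Rx)) * μ.real (D ∩ Rq)
          ≤ μ.real (D ∩ (U ∩ Rq)) * μ.real (D ∩ Rx) := key
        _ ≤ μ.real (D ∩ (U ∩ Rq)) * μ.real (D ∩ Rq) := mul_le_mul_of_nonneg_left hcmp measureReal_nonneg
        _ = μ.real (D ∩ Rq) * μ.real (D ∩ (U ∩ Rq)) := mul_comm _ _
    rw [mul_comm] at key'
    exact le_of_mul_le_mul_left key' hpos

omit [Fintype V] in
/-- If `x ↔ y` then `π(x) = π(y)`. [folklore] -/
theorem filter_eq_of_reach (A : Finset V) {x y : V} {ω : BondConfig V} (h : ω ∈ openConn x y) :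
    (A.filter fun z => ω ∈ openConn x z) = (A.filter fun z => ω ∈ openConn y z) := by
  have h' : (openGraph ω).Reachable x y := h
  exact Finset.filter_congr fun z _ =>
    ⟨fun hz => (h'.symm.trans hz : (openGraph ω).Reachable y z),
      fun hz => (h'.trans hz : (openGraph ω).Reachable x z)⟩

/-- **RHLA for a pair (both regimes).**  Let `a ≠ g` with `μ(R_g) ≤ μ(R_a)` (`a` is the lonelier = lighter member of
`B = {a, g}`) and let `x` be ANY vertex.  Then
`μ(x ↔ B, R_x) + μ(x ↮ B, 1 ≤ |π(B)| ≤ j) ≤ μ(R_a)`: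
gluing the pair `{a, g}` damages the outsider `x` no more than it damages `a`.
(`{x ↔ a}`-part: `R_x = R_a`; `{x ↮ a, x ↔ g}`-part: `attached_transfer`; `{x ↮ B}`-part: `|π(a)| ≤ |π(B)|`.) -/
theorem pair_anchored (w : Sym2 V → unitInterval) (A : Finset V) (j : ℕ) {a g : V} (hag : a ≠ g) (x : V)
    (hle : (prodBernoulli w).real {ω : BondConfig V | (A.filter fun z => ω ∈ openConn g z).card ≤ j} ≤
      (prodBernoulli w).real {ω : BondConfig V | (A.filter fun z => ω ∈ openConn a z).card ≤ j}) :
    (prodBernoulli w).real ((openConn x a ∪ openConn x g) ∩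
        {ω : BondConfig V | (A.filter fun z => ω ∈ openConn x z).card ≤ j}) +
      (prodBernoulli w).real ((openConn x a)ᶜ ∩ (openConn x g)ᶜ ∩
        {ω : BondConfig V | 1 ≤ (A.filter fun z => ω ∈ openConn a z ∨ ω ∈ openConn g z).card ∧
          (A.filter fun z => ω ∈ openConn a z ∨ ω ∈ openConn g z).card ≤ j}) ≤
      (prodBernoulli w).real {ω : BondConfig V | (A.filter fun z => ω ∈ openConn a z).card ≤ j} := by
  set μ := prodBernoulli w with hμ
  set Rx : Set (BondConfig V) := {ω | (A.filter fun z => ω ∈ openConn x z).card ≤ j} with hRx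
  set Rg : Set (BondConfig V) := {ω | (A.filter fun z => ω ∈ openConn g z).card ≤ j} with hRg
  set Ra : Set (BondConfig V) := {ω | (A.filter fun z => ω ∈ openConn a z).card ≤ j} with hRa
  set Xa : Set (BondConfig V) := openConn x a with hXa
  set Xg : Set (BondConfig V) := openConn x g with hXg
  set bad : Set (BondConfig V) := {ω | 1 ≤ (A.filter fun z => ω ∈ openConn a z ∨ ω ∈ openConn g z).card ∧
      (A.filter fun z => ω ∈ openConn a z ∨ ω ∈ openConn g z).card ≤ j} with hbad
  have hmeas : ∀ S : Set (BondConfig V), MeasurableSet S := fun S => (Set.toFinite S).measurableSet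
  -- the three pieces of `R_a`
  have hsplit1 : μ.real (Ra ∩ Xa) + μ.real (Ra \ Xa) = μ.real Ra := measureReal_inter_add_sdiff (hmeas Xa)
  have hsplit2 : μ.real ((Ra \ Xa) ∩ Xg) + μ.real ((Ra \ Xa) \ Xg) = μ.real (Ra \ Xa) :=
    measureReal_inter_add_sdiff (hmeas Xg)
  -- piece 1: on `{x ↔ a}` the loneliness of `x` is that of `a`
  have h1 : μ.real (Xa ∩ Rx) ≤ μ.real (Ra ∩ Xa) := by
    refine measureReal_mono ?_
    rintro ω ⟨hxa', hRx'⟩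
    refine ⟨?_, hxa'⟩
    simp only [hRx, hRa, mem_setOf_eq] at hRx' ⊢
    rwa [← filter_eq_of_reach A hxa']
  -- piece 2: `{x ↮ a, x ↔ g, R_x} = {a ↮ g, g ↔ x, R_g}` then the attached transfer
  have hE : Xaᶜ ∩ (Xg ∩ Rx) = (openConn a g)ᶜ ∩ (Rg ∩ openConn g x) := by
    ext ω
    simp only [hXa, hXg, hRx, hRg, mem_inter_iff, mem_compl_iff, mem_setOf_eq]
    constructor
    · rintro ⟨hna, hxg', hR⟩
      have hgx : ω ∈ openConn g x := by rw [KNPreFKG.openConn_symm]; exact hxg'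
      refine ⟨fun hag' => hna ?_, ?_, hgx⟩
      · have h1 : (openGraph ω).Reachable x g := hxg'
        have h2 : (openGraph ω).Reachable a g := hag'
        exact (h1.trans h2.symm : (openGraph ω).Reachable x a)
      · rwa [← filter_eq_of_reach A hxg']
    · rintro ⟨hnag, hR, hgx⟩
      have hxg' : ω ∈ openConn x g := by rw [KNPreFKG.openConn_symm]; exact hgx
      refine ⟨fun hxa' => hnag ?_, hxg', ?_⟩
      · have h1 : (openGraph ω).Reachable x a := hxa'
        have h2 : (openGraph ω).Reachable x g := hxg'
        exact (h1.symm.trans h2 : (openGraph ω).Reachable a g)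
      · rwa [filter_eq_of_reach A hxg']
  have h2 : μ.real (Xaᶜ ∩ (Xg ∩ Rx)) ≤ μ.real ((Ra \ Xa) ∩ Xg) := by
    rw [hE]
    refine (attached_transfer w A j hag.symm x hle).trans (measureReal_mono ?_)
    rintro ω ⟨hnag, hgx, hR⟩
    have hxg' : ω ∈ openConn x g := by rw [KNPreFKG.openConn_symm]; exact hgx
    refine ⟨⟨hR, fun hxa' => hnag ?_⟩, hxg'⟩
    have h1 : (openGraph ω).Reachable x a := hxa'
    have h2 : (openGraph ω).Reachable x g := hxg'
    exact (h1.symm.trans h2 : (openGraph ω).Reachable a g)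
  -- piece 3: `bad ⊆ R_a`
  have h3 : μ.real (Xaᶜ ∩ Xgᶜ ∩ bad) ≤ μ.real ((Ra \ Xa) \ Xg) := by
    refine measureReal_mono ?_
    rintro ω ⟨⟨hna, hng⟩, _, hle'⟩
    refine ⟨⟨?_, hna⟩, hng⟩
    simp only [hRa, mem_setOf_eq]
    refine le_trans (Finset.card_le_card ?_) hle'
    intro z hz
    rw [Finset.mem_filter] at hz ⊢
    exact ⟨hz.1, Or.inl hz.2⟩
  -- the union splits
  have hU : μ.real ((Xa ∪ Xg) ∩ Rx) ≤ μ.real (Xa ∩ Rx) + μ.real (Xaᶜ ∩ (Xg ∩ Rx)) := by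
    refine (measureReal_mono ?_).trans (measureReal_union_le _ _)
    rintro ω ⟨hU', hR⟩
    by_cases hxa' : ω ∈ Xa
    · exact Or.inl ⟨hxa', hR⟩
    · rcases hU' with h | h
      · exact absurd h hxa'
      · exact Or.inr ⟨hxa', h, hR⟩
  linarith

/-- **RHLA in the easy regime (any size of `B`).**  Let `B` be a finite vertex set, `q ∈ B`, and `x ≠ q` a
vertex with `μ(R_x) ≤ μ(R_q)` (`q` at least as light as `x`).  Then
`μ(x ↔ B, R_x) + μ(x ↮ B, 1 ≤ |π(B)| ≤ j) ≤ μ(R_q)`.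
For `B = {q, h}` this is `ExchangeTools.glueCost_le`; rewritten as `Δ(B; x) ≥ I(x) − I(q)` it is the additive
form of `observerSet_le_of_lonelier`. (`{x ↔ q}`: `R_x = R_q`; `{x ↮ q, x ↔ B∖q}`: `union_transfer`;
`{x ↮ B}`: `|π(q)| ≤ |π(B)|`.) -/
theorem set_anchored_of_le (w : Sym2 V → unitInterval) (A : Finset V) (j : ℕ) (B : Finset V) {q x : V}
    (hq : q ∈ B) (hxq : x ≠ q)
    (hle : (prodBernoulli w).real {ω : BondConfig V | (A.filter fun z => ω ∈ openConn x z).card ≤ j} ≤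
      (prodBernoulli w).real {ω : BondConfig V | (A.filter fun z => ω ∈ openConn q z).card ≤ j}) :
    (prodBernoulli w).real ((⋃ b ∈ B, (openConn x b : Set (BondConfig V))) ∩
        {ω : BondConfig V | (A.filter fun z => ω ∈ openConn x z).card ≤ j}) +
      (prodBernoulli w).real ((⋂ b ∈ B, (openConn x b : Set (BondConfig V))ᶜ) ∩
        {ω : BondConfig V | 1 ≤ (A.filter fun z => ∃ b ∈ B, ω ∈ openConn b z).card ∧
          (A.filter fun z => ∃ b ∈ B, ω ∈ openConn b z).card ≤ j}) ≤
      (prodBernoulli w).real {ω : BondConfig V | (A.filter fun z => ω ∈ openConn q z).card ≤ j} := by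
  set μ := prodBernoulli w with hμ
  set Rx : Set (BondConfig V) := {ω | (A.filter fun z => ω ∈ openConn x z).card ≤ j} with hRx
  set Rq : Set (BondConfig V) := {ω | (A.filter fun z => ω ∈ openConn q z).card ≤ j} with hRq
  set Xq : Set (BondConfig V) := openConn x q with hXq
  set U : Set (BondConfig V) := ⋃ b ∈ B, (openConn x b : Set (BondConfig V)) with hU
  set U' : Set (BondConfig V) := ⋃ b ∈ B.erase q, (openConn x b : Set (BondConfig V)) with hU'
  set bad : Set (BondConfig V) := {ω | 1 ≤ (A.filter fun z => ∃ b ∈ B, ω ∈ openConn b z).card ∧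
      (A.filter fun z => ∃ b ∈ B, ω ∈ openConn b z).card ≤ j} with hbad
  have hmeas : ∀ S : Set (BondConfig V), MeasurableSet S := fun S => (Set.toFinite S).measurableSet
  have hsplit1 : μ.real (Rq ∩ Xq) + μ.real (Rq \ Xq) = μ.real Rq := measureReal_inter_add_sdiff (hmeas Xq)
  have hsplit2 : μ.real ((Rq \ Xq) ∩ U') + μ.real ((Rq \ Xq) \ U') = μ.real (Rq \ Xq) :=
    measureReal_inter_add_sdiff (hmeas U')
  -- piece 1
  have h1 : μ.real (Xq ∩ Rx) ≤ μ.real (Rq ∩ Xq) := by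
    refine measureReal_mono ?_
    rintro ω ⟨hxq', hR⟩
    refine ⟨?_, hxq'⟩
    simp only [hRx, hRq, mem_setOf_eq] at hR ⊢
    rwa [← filter_eq_of_reach A hxq']
  -- piece 2
  have h2 : μ.real (Xqᶜ ∩ (U' ∩ Rx)) ≤ μ.real ((Rq \ Xq) ∩ U') := by
    refine (union_transfer w A j hxq (B.erase q) hle).trans (measureReal_mono ?_)
    rintro ω ⟨hnq, hu, hR⟩
    exact ⟨⟨hR, hnq⟩, hu⟩
  -- piece 3
  have h3 : μ.real ((⋂ b ∈ B, (openConn x b : Set (BondConfig V))ᶜ) ∩ bad) ≤ μ.real ((Rq \ Xq) \ U') := by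
    refine measureReal_mono ?_
    rintro ω ⟨hI, _, hle'⟩
    rw [mem_iInter₂] at hI
    refine ⟨⟨?_, hI q hq⟩, ?_⟩
    · simp only [hRq, mem_setOf_eq]
      refine le_trans (Finset.card_le_card ?_) hle'
      intro z hz
      rw [Finset.mem_filter] at hz ⊢
      exact ⟨hz.1, q, hq, hz.2⟩
    · intro hu
      rw [hU', mem_iUnion₂] at hu
      obtain ⟨b, hb, hωb⟩ := hu
      exact hI b (Finset.mem_of_mem_erase hb) hωb
  -- the union splits
  have hUle : μ.real (U ∩ Rx) ≤ μ.real (Xq ∩ Rx) + μ.real (Xqᶜ ∩ (U' ∩ Rx)) := by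
    refine (measureReal_mono ?_).trans (measureReal_union_le _ _)
    rintro ω ⟨hu, hR⟩
    by_cases hxq' : ω ∈ Xq
    · exact Or.inl ⟨hxq', hR⟩
    · right
      refine ⟨hxq', ?_, hR⟩
      rw [hU, mem_iUnion₂] at hu
      obtain ⟨b, hb, hωb⟩ := hu
      have hbq : b ≠ q := by rintro rfl; exact hxq' hωb
      rw [hU', mem_iUnion₂]
      exact ⟨b, Finset.mem_erase.2 ⟨hbq, hb⟩, hωb⟩
  linarith


end AnchoredLonelier

end Summit.CriticalPhenomena.PercolationContinuityZ3.Theorems
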